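import Mathlib

/-!
# Crux-triage r1-1 (gen 2) scratch — refuter-cruxtri-stmt-Langlands-12919-r1-1-g2-0

Independent kernel checks for the round-1 triage of crux `stmt-Langlands-12919`
(`SkinnerWilesDefectOne.ReducibleOrdinaryProModular`).  Deliberately DIFFERENT content from
`TriageScratch-r1-2.lean` (tame pin / transverse pin / level-raising factor, already
kernel-checked there and re-read by me):

* §1 `no_tangent_free_lunch` — card `unibranch-eisenstein-sheets`, cheapest falsifier (1):
  the first-order nearly-ordinary condition at a place `v ∣ p`, in entries, for the deformed
  reducible point `ρ_ε = (ψ₁(1+εa), b+εβ; εx, ψ₂(1+εd))` and the deformed ordinary line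
  `⟨(u+εy) e₁ + e₂⟩`.  Result: the condition reads `β + u (ψ₁ a − ψ₂ d) − x u² = y (ψ₂ − ψ₁)`,
  so the LOWER-LEFT cocycle `x` DOES enter at first order, with coefficient `u²`, vanishing only
  in a `v`-adapted global basis (`u = 0`, i.e. `b|_{G_v} = 0` on the nose) — available at ONE
  of the two places above `p`, not both.  The card's "no first-order condition on the lower-left
  cocycle" is therefore inexact, but its tangent UPPER bound survives (TRIAGE.md).
* §2 `DecGen` — card `eisenstein-lgc-at-nice-prime`, cheapest falsifier (2) as LITERALLY posed
  (the untwisted 4-dimensional `ρ̄ ⊕ ρ̄ᶜ`, `ρ̄^ss = θ ⊕ ωθ⁻¹`, `det = ω`, `ω⁴ = 1 mod 5`), decided in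
  `ZMod 5` (`general_census`): generic at `v` iff `ℓ ≡ −1 (mod 5)` and `θ(v) = θ(v̄) = ±2`;
  §3 its strict (ACC+ Def. 4.3.1) version never holds untwisted — harmless, because ACC+ twist;
  §4 the BINDING 2-dimensional condition (`gen2_census`, `gen2Strict_census`): exceptional list
  `θ² ∈ {1, ω²}` for both notions, rational 5-torsion points never generic.
-/

namespace TriageR11g2

/-! ### §1 First-order nearly-ordinary condition at `v ∣ p` on an Eisenstein sheet -/

/-- Entries form of `ρ_ε(g) · w_ε = λ_ε(g) · w_ε` over a ring with `e² = 0`: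
`ρ_ε(g) = (p₁(1+e a), b + e β; e x, p₂(1+e d))`, `w_ε = (u + e y, 1)`; the second component
forces `λ_ε = p₂(1 + e d) + e x u`; given the order-0 relation `p₁ u + b = p₂ u` (the line
`⟨u e₁ + e₂⟩` is `G_v`-stable for `ρ_η|_{G_v}`), the first component holds iff
`β + u (p₁ a − p₂ d) − x u² = y (p₂ − p₁)` (times `e`).  [folklore 2×2 computation] -/
theorem no_tangent_free_lunch {A : Type*} [CommRing A] (e p₁ p₂ a b d β x u y : A)
    (he : e * e = 0) (h0 : p₁ * u + b = p₂ * u) :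
    (p₁ * (1 + e * a)) * (u + e * y) + (b + e * β) =
        (p₂ * (1 + e * d) + e * x * u) * (u + e * y) ↔
      e * (β + u * (p₁ * a - p₂ * d) - x * u ^ 2 - y * (p₂ - p₁)) = 0 := by
  constructor
  · intro h
    linear_combination h - h0 + (x * u * y + p₂ * d * y - p₁ * a * y) * he
  · intro h
    linear_combination h + h0 - (x * u * y + p₂ * d * y - p₁ * a * y) * he

/-- The second component is an identity once `λ_ε := p₂(1+e d) + e x u` (no condition). -/
theorem second_component {A : Type*} [CommRing A] (e p₂ d x u y : A) (he : e * e = 0) :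
    e * x * (u + e * y) + p₂ * (1 + e * d) * 1 = (p₂ * (1 + e * d) + e * x * u) * 1 := by
  linear_combination x * y * he

/-- In a `v`-ADAPTED basis (`u = 0`) the lower-left entry `x` drops out: the condition is
`β = y (p₂ − p₁)`, a condition on the upper-right class only (the card's claim, true at one
place). -/
theorem adapted_basis_no_x {A : Type*} [CommRing A] (e p₁ p₂ a d β x y : A) :
    e * (β + 0 * (p₁ * a - p₂ * d) - x * (0 : A) ^ 2 - y * (p₂ - p₁)) = 0 ↔
      e * (β - y * (p₂ - p₁)) = 0 := by
  constructor <;> intro h <;> linear_combination h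

/-! ### §2 Decomposed genericity census at `p = 5` -/

/-- Decomposed genericity of a 4-tuple of Frobenius eigenvalues at a split place of residue
characteristic `ℓ` (as an element of `ZMod 5`): no ordered pair of DISTINCT indices has ratio
`ℓ`. [cite: CaraianiNewton2023, Def. 2.1.27] (shape only) -/
def DecGen (ℓ : ZMod 5) (e : Fin 4 → ZMod 5) : Prop :=
  ∀ i j : Fin 4, i ≠ j → e i ≠ ℓ * e j

instance (ℓ : ZMod 5) (e : Fin 4 → ZMod 5) : Decidable (DecGen ℓ e) := by
  unfold DecGen; infer_instance

/-- Rational 5-torsion POINT population (`θ = 1`, `ρ̄^ss = 1 ⊕ ω`): eigenvalues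
`{1, ℓ, 1, ℓ}` are never decomposed generic, whatever the split prime. -/
theorem torsionPoint_never_generic : ∀ ℓ : ZMod 5, ℓ ≠ 0 → ¬ DecGen ℓ ![1, ℓ, 1, ℓ] := by
  decide

/-- Base-change-shaped isogeny data (`θ(v̄) = θ(v) = θ`, `θi = θ⁻¹`): eigenvalues
`{θ, ℓθ⁻¹, θ, ℓθ⁻¹}` are decomposed generic IFF `θ² = 4` (θ(Frob_v) = ±2, exact order 4 at `v`)
AND `ℓ = 4 ≡ −1 (mod 5)`.  So for `θ` trivial or quadratic genericity fails at every split prime,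
and even for `θ` of order 4 only the primes `ℓ ≡ −1 (mod 5)` with `θ(Frob_v) = ±2` work. -/
theorem baseChange_census :
    ∀ θ θi ℓ : ZMod 5, θ * θi = 1 → ℓ ≠ 0 →
      (DecGen ℓ ![θ, ℓ * θi, θ, ℓ * θi] ↔ (θ ^ 2 = 4 ∧ ℓ = 4)) := by
  decide

/-- General isogeny data (`θ' := θ(v̄)` free, `θi' = θ'⁻¹`): generic triples exist, e.g.
`θ = θ' = 2`, `ℓ = 4` (all four eigenvalues equal `2`; ratios `1 ≠ 4`). -/
theorem general_exists : ∃ θ θi θ' θi' ℓ : ZMod 5, θ * θi = 1 ∧ θ' * θi' = 1 ∧ ℓ ≠ 0 ∧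
    DecGen ℓ ![θ, ℓ * θi, θ', ℓ * θi'] := by decide

/-- With `ℓ ≡ 1 (mod 5)` genericity needs four DISTINCT eigenvalues, impossible for the
shape `{θ, θ⁻¹, θ', θ'⁻¹}` in `(ZMod 5)ˣ` (order-4 values come in inverse pairs `{2, 3}`):
split primes `ℓ ≡ 1 (mod 5)` are NEVER decomposed generic for 5-isogeny data. -/
theorem ell_one_never : ∀ θ θi θ' θi' : ZMod 5, θ * θi = 1 → θ' * θi' = 1 →
    ¬ DecGen 1 ![θ, 1 * θi, θ', 1 * θi'] := by decide

/-- `θ(Frob_v)² = 1` kills genericity at `v` for every `θ'`, `ℓ` (first half of the panel's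
exceptional list "θ² ∈ {1, ω²}"). -/
theorem theta_sq_one_never : ∀ θ θi θ' θi' ℓ : ZMod 5, θ * θi = 1 → θ' * θi' = 1 → ℓ ≠ 0 →
    θ ^ 2 = 1 → ¬ DecGen ℓ ![θ, ℓ * θi, θ', ℓ * θi'] := by decide

/-- FULL CENSUS for general 5-isogeny data: decomposed generic at the split place `v`
(`N v ≡ ℓ`) iff `ℓ ≡ −1 (mod 5)` AND `θ(Frob_v) = θ(Frob_v̄) = ±2` — decided exhaustively
(by hand: `θ², θ'² ∉ {1, ℓ²}`, `θθ' ∉ {1, ℓ²}`, `θ ≠ ℓθ'`, `θ' ≠ ℓθ`).  Hence by Čebotarev a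
decomposed-generic prime exists iff some `σ ∈ G_F` has `ω(σ) = −1`, `θ(σ) = θᶜ(σ) = ±2`,
which fails identically exactly for `θ ∈ Quad ∪ ω·Quad` (`θ² ∈ {1, ω²}`; note `ω²` is
quadratic mod 5) — the panel's exceptional list X3, now kernel-checked at the finite level. -/
theorem general_census : ∀ θ θi θ' θi' ℓ : ZMod 5, θ * θi = 1 → θ' * θi' = 1 → ℓ ≠ 0 →
    (DecGen ℓ ![θ, ℓ * θi, θ', ℓ * θi'] ↔ (ℓ = 4 ∧ θ ^ 2 = 4 ∧ θ' = θ)) := by decide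


/-! ### §3 The STRICT (compact-case) genericity of ACC+ Def. 4.3.1 never holds at `p = 5` -/

/-- ACC+ (arXiv:1812.09999) Definition 4.3.1 / [CS compact]: generic means `α_i/α_j ∉ {1, ℓ}` for
`i ≠ j` — eigenvalues pairwise DISTINCT and no ratio `ℓ`.  This is the hypothesis "ρ̄_𝔪 decomposed
generic" of ACC+'s ordinary local–global compatibility theorem (ch. 5, "[F⁺:ℚ] > 1"), as opposed to
the relaxed `DecGen` of CN23 Def. 2.1.27 / CS non-compact. -/
def DecGenStrict (ℓ : ZMod 5) (e : Fin 4 → ZMod 5) : Prop :=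
  ∀ i j : Fin 4, i ≠ j → e i ≠ ℓ * e j ∧ e i ≠ e j

instance (ℓ : ZMod 5) (e : Fin 4 → ZMod 5) : Decidable (DecGenStrict ℓ e) := by
  unfold DecGenStrict; infer_instance

/-- The UNTWISTED 4-dimensional sum `ρ̄ ⊕ ρ̄ᶜ` of a 5-isogeny datum is never decomposed generic in
the STRICT sense (for `ℓ ≢ 1` four pairwise distinct values exhaust `(ZMod 5)ˣ`, so every ratio
`≠ 1` occurs, including `ℓ`; for `ℓ ≡ 1` the shape `{θ, θ⁻¹, θ', θ'⁻¹}` repeats).  This does NOT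
obstruct the theorems: ACC+ (p0040 L48–52 of the text dump) assume only that the 2-dimensional
`ρ̄_𝔪` is decomposed generic and TWIST by a character `ψ̄` with values in an enlarged `k` to make
`(ρ̄⊗ψ̄) ⊕ (ρ̄⊗ψ̄)^{c,∨}ε^{1−2n}` generic — the binding condition is the 2-dimensional one (§4). -/
theorem strict_never : ∀ θ θi θ' θi' ℓ : ZMod 5, θ * θi = 1 → θ' * θi' = 1 → ℓ ≠ 0 →
    ¬ DecGenStrict ℓ ![θ, ℓ * θi, θ', ℓ * θi'] := by decide

/-- (Sanity: the strict notion is NOT empty in general — at `ℓ ≡ 1 (mod 5)` it is plain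
distinctness, e.g. `(1,2,3,4)`; it is the isogeny SHAPE `{θ, ℓθ⁻¹, θ', ℓθ'⁻¹}` that kills it,
through `ell_one_never` at `ℓ ≡ 1` and pigeonhole at `ℓ ≢ 1`.) -/
example : DecGenStrict 1 ![1, 2, 3, 4] := by decide


/-! ### §4 The binding (2-dimensional) condition, strict and relaxed -/

/-- Relaxed (CN23 Def. 2.1.27) genericity of the 2-dimensional `ρ̄ = θ ⊕ ωθ⁻¹` at a split `v`. -/
def Gen2 (ℓ θ θi : ZMod 5) : Prop := θ ≠ ℓ * (ℓ * θi) ∧ ℓ * θi ≠ ℓ * θ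

/-- Strict (ACC+ Def. 4.3.1) genericity of the 2-dimensional `ρ̄` at a split `v`. -/
def Gen2Strict (ℓ θ θi : ZMod 5) : Prop := Gen2 ℓ θ θi ∧ θ ≠ ℓ * θi

instance (ℓ θ θi : ZMod 5) : Decidable (Gen2 ℓ θ θi) := by unfold Gen2; infer_instance
instance (ℓ θ θi : ZMod 5) : Decidable (Gen2Strict ℓ θ θi) := by
  unfold Gen2Strict; infer_instance

/-- Relaxed 2-dim census: generic at `v` iff `θ(Frob_v) = ±2` and `N v ≡ ±1 (mod 5)`. -/
theorem gen2_census : ∀ ℓ θ θi : ZMod 5, θ * θi = 1 → ℓ ≠ 0 →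
    (Gen2 ℓ θ θi ↔ (θ ^ 2 = 4 ∧ ℓ ^ 2 = 1)) := by decide

/-- Strict 2-dim census: generic at `v` iff `θ(Frob_v) = ±2` and `N v ≡ 1 (mod 5)`.  Either way a
suitable `σ` (θ²(σ) = −1 with ω²(σ) = 1, resp. ω(σ) = 1) exists by Čebotarev unless `θ² ∈ {1, ω²}`
— the SAME exceptional list (rational 5-torsion points `θ = 1` included) for both notions. -/
theorem gen2Strict_census : ∀ ℓ θ θi : ZMod 5, θ * θi = 1 → ℓ ≠ 0 →
    (Gen2Strict ℓ θ θi ↔ (θ ^ 2 = 4 ∧ ℓ = 1)) := by decide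

end TriageR11g2
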